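import Literature.Probability.RandomPlanarGeometry.SLEThrIncrements
import Literature.Probability.RandomPlanarGeometry.LoewnerThrFlowDefs
import HarnessLib

/-!
# The through-swallow image chain of SLE₆: the stopped driving process as the sum of its piece increments

Sequel of `SLEThrIncrements` (Lawler–Schramm–Werner (2001) Thm. 2.2 / G. F. Lawler (2005) §6.3 Thm. 6.13:
gluing of the image driving martingales through the swallow instants). Theorems only, pathwise (a sample
satisfying the cluster dichotomy up to the finite horizon `H ω`):

* `sum_stoppedProcess_sub_eq` — telescoping of any process over the pieces:
  `∑_s (F_{t ∧ σ_s} − F_{t ∧ ρ_s}) = F_{t ∧ H} − F_0`;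
* `stoppedProcess_thrImageDriver_eq_sum`, `thrClock_eq_sum` — the stopped through-swallow driving value
  `U*_{t ∧ H}` and the clock `σ_A(t ∧ H)` as the sums of their piece increments;
* `tendsto_thrLevelSum`, `tendsto_stoppedValue_thrLevelSum`, `tendsto_sum_pieceClockIncr`,
  `tendsto_thrLevelBracket` — the level-`n` approximations converge to `U*_{t ∧ H}`, `U*_{ρ_s}`,
  `σ_A(t ∧ H)` and `(U*_{t ∧ H})² − 6 σ_A(t ∧ H)`;
* `continuous_stoppedProcess_thrDrv_sub`, `continuous_stoppedProcess_thrImageDriver` — the stopped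
  through-swallow driving process has continuous paths (on each piece it is the continuous image driving
  function of the piece hull, left-continuous at the contact time by the continuity of the shift,
  `Loewner.tendsto_starShift_slidHull_hullHitTime`).

## References

* G. F. Lawler, O. Schramm, W. Werner, Acta Math. **187** (2001), Thm. 2.2. [LawlerSchrammWerner2001]
* G. F. Lawler (2005), §6.3 Thm. 6.13. [Lawler2005]
-/

noncomputable section

open Set Filter Metric Function MeasureTheory
open _root_.Complex _root_.Topology
open scoped NNReal

namespace Literature.Probability.RandomPlanarGeometry

open Loewner Literature.Probability.Process

variable {κ : ℝ≥0} {A : Set ℂ} {hA : IsStarHull A} {δ : ℝ} {hδ : 0 < δ} {H : (ℝ≥0 → ℝ) → WithTop ℝ≥0}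

/-! ### Telescoping over the pieces, on the Wiener space -/

/-- **Telescoping of a function of time over the pieces `[ρ_s, σ_s)`**: for every `F` and every `t`,
`∑_s (F (t ∧ σ_s) − F (t ∧ ρ_s)) = F (t ∧ H) − F 0`. [folklore] -/
theorem sum_stoppedProcess_sub_eq (hA : IsStarHull A) (hδ : 0 < δ) (F : ℝ≥0 → (ℝ≥0 → ℝ) → ℝ) (t : ℝ≥0) (ω : ℝ≥0 → ℝ) :
    ∑ s ∈ (clusterFinset hA hδ).powerset,
      (stoppedProcess F (thrSigma κ hA hδ H s) t ω - stoppedProcess F (thrRho κ hA hδ H s) t ω) =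
      F (min (t : WithTop ℝ≥0) (H ω)).untopA ω - F 0 ω := by
  have h := sum_powerset_telescope (clusterFinset hA hδ) (fun Q ↦ hullHitTime (drvK κ (brownianCPath ω)) Q)
    (fun x ↦ F (min (t : WithTop ℝ≥0) x).untopA ω) (H ω)
  have h0 : (min (t : WithTop ℝ≥0) (min ⊥ (H ω))).untopA = 0 := by
    rw [min_eq_left (bot_le : (⊥ : WithTop ℝ≥0) ≤ H ω), min_eq_right (bot_le : (⊥ : WithTop ℝ≥0) ≤ t)]; rfl
  simp only [h0] at h
  simp only [stoppedProcess]
  exact h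

/-! ### The stopped through-swallow driving process as the sum of its piece increments -/

section Pathwise

variable {ω : ℝ≥0 → ℝ}

/-- **`U*_{t ∧ H} = ∑_s (X_{t ∧ σ_s} − X_{t ∧ ρ_s})`** (`X = thrDrv = U* − L_A`, `U*_0 = 0`). [folklore] -/
theorem stoppedProcess_thrImageDriver_eq_sum (hA : IsStarHull A) (hδ : 0 < δ) (t : ℝ≥0) (ω : ℝ≥0 → ℝ) :
    stoppedProcess (fun t ω ↦ thrImageDriver (drvK κ (brownianCPath ω)) A t) H t ω =
      ∑ s ∈ (clusterFinset hA hδ).powerset,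
        (stoppedProcess (thrDrv κ A) (thrSigma κ hA hδ H s) t ω - stoppedProcess (thrDrv κ A) (thrRho κ hA hδ H s) t ω) := by
  have h := sum_stoppedProcess_sub_eq (κ := κ) (H := H) hA hδ (thrDrv κ A) t ω
  have h0 : thrDrv κ A 0 ω = -(starShift A).re := by
    rw [thrDrv, thrImageDriver_zero (continuous_drvK κ _) (drvK_zero κ _) hA, zero_sub]
  have e : thrDrv κ A (min (t : WithTop ℝ≥0) (H ω)).untopA ω - thrDrv κ A 0 ω =
      stoppedProcess (fun t ω ↦ thrImageDriver (drvK κ (brownianCPath ω)) A t) H t ω := by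
    rw [h0, thrDrv, sub_neg_eq_add, sub_add_cancel, stoppedProcess]
  rw [e] at h
  exact h.symm

/-- **The through-swallow clock as the sum of its piece increments**:
`σ_A(t ∧ H) = ∑_s (σ_A(t ∧ σ_s) − σ_A(t ∧ ρ_s))`. [folklore] -/
theorem thrClock_eq_sum (hA : IsStarHull A) (hδ : 0 < δ) (t : ℝ≥0) (ω : ℝ≥0 → ℝ) :
    thrClock (drvK κ (brownianCPath ω)) A ((min (t : WithTop ℝ≥0) (H ω)).untopA : ℝ≥0) =
      ∑ s ∈ (clusterFinset hA hδ).powerset,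
        (thrClock (drvK κ (brownianCPath ω)) A ((min (t : WithTop ℝ≥0) (thrSigma κ hA hδ H s ω)).untopA : ℝ≥0) -
          thrClock (drvK κ (brownianCPath ω)) A ((min (t : WithTop ℝ≥0) (thrRho κ hA hδ H s ω)).untopA : ℝ≥0)) := by
  have h := sum_stoppedProcess_sub_eq (κ := κ) (H := H) hA hδ (fun u (_ : ℝ≥0 → ℝ) ↦ thrClock (drvK κ (brownianCPath ω)) A u) t ω
  simp only [stoppedProcess] at h
  rw [NNReal.coe_zero, thrClock_zero, sub_zero] at h
  exact h.symm

/-- **The level-`n` sums converge to the stopped through-swallow driving process** `U*_{t ∧ H}`.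
[cite: Lawler2005, §6.3 Thm. 6.13] -/
theorem tendsto_thrLevelSum
    (hclw : ∀ t : ℝ≥0, (t : WithTop ℝ≥0) ≤ H ω → ∀ a ∈ A, deltaCluster A δ a ⊆ closedHull (drvK κ (brownianCPath ω)) t ∨
      Disjoint (deltaCluster A δ a) (closedHull (drvK κ (brownianCPath ω)) t)) (t : ℝ≥0) :
    Tendsto (fun n ↦ thrLevelSum κ hA hδ H n t ω) atTop
      (𝓝 (stoppedProcess (fun t ω ↦ thrImageDriver (drvK κ (brownianCPath ω)) A t) H t ω)) := by
  rw [stoppedProcess_thrImageDriver_eq_sum hA hδ t ω]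
  exact tendsto_finsetSum _ fun s hs ↦ tendsto_pieceIncr (Finset.mem_powerset.1 hs) hclw t

/-- The level-`n` sums read at the start of a piece converge. [folklore] -/
theorem tendsto_stoppedValue_thrLevelSum (hH : H ω ≠ ⊤)
    (hclw : ∀ t : ℝ≥0, (t : WithTop ℝ≥0) ≤ H ω → ∀ a ∈ A, deltaCluster A δ a ⊆ closedHull (drvK κ (brownianCPath ω)) t ∨
      Disjoint (deltaCluster A δ a) (closedHull (drvK κ (brownianCPath ω)) t)) (s : Finset (Set ℂ)) :
    Tendsto (fun n ↦ stoppedValue (thrLevelSum κ hA hδ H n) (thrRho κ hA hδ H s) ω) atTop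
      (𝓝 (thrImageDriver (drvK κ (brownianCPath ω)) A (thrRho κ hA hδ H s ω).untopA)) := by
  have h := tendsto_thrLevelSum (hA := hA) (hδ := hδ) (H := H) hclw (thrRho κ hA hδ H s ω).untopA
  have hρ : (((thrRho κ hA hδ H s ω).untopA : ℝ≥0) : WithTop ℝ≥0) = thrRho κ hA hδ H s ω := by
    rw [WithTop.untopA_eq_untop (ne_top_of_le_ne_top hH (thrRho_le s ω)), WithTop.coe_untop]
  have hmin : (min (((thrRho κ hA hδ H s ω).untopA : ℝ≥0) : WithTop ℝ≥0) (H ω)).untopA = (thrRho κ hA hδ H s ω).untopA := by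
    rw [min_eq_left (hρ.trans_le (thrRho_le s ω))]; rfl
  simp only [stoppedProcess, hmin] at h
  exact h

/-- **The level-`n` clock sums converge to the through-swallow clock** `σ_A(t ∧ H)`. [folklore] -/
theorem tendsto_sum_pieceClockIncr (hH : H ω ≠ ⊤)
    (hclw : ∀ t : ℝ≥0, (t : WithTop ℝ≥0) ≤ H ω → ∀ a ∈ A, deltaCluster A δ a ⊆ closedHull (drvK κ (brownianCPath ω)) t ∨
      Disjoint (deltaCluster A δ a) (closedHull (drvK κ (brownianCPath ω)) t)) (t : ℝ≥0) :
    Tendsto (fun n ↦ ∑ s ∈ (clusterFinset hA hδ).powerset, pieceClockIncr κ hA hδ H s n t ω) atTop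
      (𝓝 (thrClock (drvK κ (brownianCPath ω)) A ((min (t : WithTop ℝ≥0) (H ω)).untopA : ℝ≥0))) := by
  rw [thrClock_eq_sum hA hδ t ω]
  exact tendsto_finsetSum _ fun s hs ↦ tendsto_pieceClockIncr (Finset.mem_powerset.1 hs) hH hclw t

/-- **The level-`n` compensated squares converge to `(U*_{t ∧ H})² − 6 σ_A(t ∧ H)`.**
[cite: Lawler2005, §6.3 Thm. 6.13] -/
theorem tendsto_thrLevelBracket (hH : H ω ≠ ⊤)
    (hclw : ∀ t : ℝ≥0, (t : WithTop ℝ≥0) ≤ H ω → ∀ a ∈ A, deltaCluster A δ a ⊆ closedHull (drvK κ (brownianCPath ω)) t ∨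
      Disjoint (deltaCluster A δ a) (closedHull (drvK κ (brownianCPath ω)) t)) (t : ℝ≥0) :
    Tendsto (fun n ↦ thrLevelBracket κ hA hδ H n t ω) atTop
      (𝓝 (stoppedProcess (fun t ω ↦ thrImageDriver (drvK κ (brownianCPath ω)) A t) H t ω ^ 2 -
        6 * thrClock (drvK κ (brownianCPath ω)) A ((min (t : WithTop ℝ≥0) (H ω)).untopA : ℝ≥0))) := by
  set W := drvK κ (brownianCPath ω) with hWdef
  set Pw := (clusterFinset hA hδ).powerset with hPw
  -- notation for the limits
  set D : Finset (Set ℂ) → ℝ := fun s ↦ stoppedProcess (thrDrv κ A) (thrSigma κ hA hδ H s) t ω -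
    stoppedProcess (thrDrv κ A) (thrRho κ hA hδ H s) t ω with hD
  set C : Finset (Set ℂ) → ℝ := fun s ↦ thrClock W A ((min (t : WithTop ℝ≥0) (thrSigma κ hA hδ H s ω)).untopA : ℝ≥0) -
    thrClock W A ((min (t : WithTop ℝ≥0) (thrRho κ hA hδ H s ω)).untopA : ℝ≥0) with hC
  set Uρ : Finset (Set ℂ) → ℝ := fun s ↦ thrImageDriver W A (thrRho κ hA hδ H s ω).untopA with hUρ
  have hlim : Tendsto (fun n ↦ thrLevelBracket κ hA hδ H n t ω) atTop (𝓝 (∑ s ∈ Pw, (D s ^ 2 - 6 * C s + 2 * Uρ s * D s))) := by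
    refine tendsto_finsetSum _ fun s hs ↦ ?_
    have hs' := Finset.mem_powerset.1 hs
    have h1 := tendsto_pieceIncr (κ := κ) (H := H) hs' hclw t
    have h2 := tendsto_pieceClockIncr (κ := κ) hs' hH hclw t
    have h3 := tendsto_stoppedValue_thrLevelSum (hA := hA) (hδ := hδ) (H := H) hH hclw s
    exact ((h1.pow 2).sub (tendsto_const_nhds.mul h2)).add ((tendsto_const_nhds.mul h3).mul h1)
  -- the algebra of the limit: `∑ (D² + 2 Uρ D) = U²`, `∑ C = σ_A(t ∧ H)`
  have hsq : ∑ s ∈ Pw, (D s ^ 2 + 2 * Uρ s * D s) = stoppedProcess (fun t ω ↦ thrImageDriver (drvK κ (brownianCPath ω)) A t) H t ω ^ 2 := by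
    have h := sum_stoppedProcess_sub_eq (κ := κ) (H := H) hA hδ (fun u ω' ↦ (thrDrv κ A u ω' - thrDrv κ A 0 ω') ^ 2) t ω
    have h0 : thrDrv κ A 0 ω = -(starShift A).re := by
      rw [thrDrv, thrImageDriver_zero (continuous_drvK κ _) (drvK_zero κ _) hA, zero_sub]
    simp only [stoppedProcess, sub_self, zero_pow two_ne_zero, sub_zero] at h
    have hU : (thrDrv κ A (min (t : WithTop ℝ≥0) (H ω)).untopA ω - thrDrv κ A 0 ω) ^ 2 =
        stoppedProcess (fun t ω ↦ thrImageDriver (drvK κ (brownianCPath ω)) A t) H t ω ^ 2 := by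
      rw [h0, thrDrv, sub_neg_eq_add, sub_add_cancel, stoppedProcess]
    rw [← hU, ← h]
    refine Finset.sum_congr rfl fun s hs ↦ ?_
    -- per-piece algebra: `(uσ)² − (uρ)² = D² + 2 Uρ D` with `uσ = uρ + D`, `uρ D = Uρ D`
    rcases le_or_gt (t : WithTop ℝ≥0) (thrRho κ hA hδ H s ω) with htρ | hρt
    · have htσ : (t : WithTop ℝ≥0) ≤ thrSigma κ hA hδ H s ω := htρ.trans (thrRho_le_thrSigma s ω)
      simp only [hD, stoppedProcess_eq_of_le htρ, stoppedProcess_eq_of_le htσ, sub_self, min_eq_left htρ, min_eq_left htσ]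
      ring
    · have hfin : thrRho κ hA hδ H s ω ≠ ⊤ := ne_top_of_le_ne_top hH (thrRho_le s ω)
      have hρle : thrRho κ hA hδ H s ω ≤ H ω := thrRho_le s ω
      obtain ⟨ρ', hρ'⟩ := WithTop.ne_top_iff_exists.1 hfin
      have hmin : (min (t : WithTop ℝ≥0) (thrRho κ hA hδ H s ω)).untopA = ρ' := by rw [min_eq_right hρt.le, ← hρ']; rfl
      have hρ'h : ((ρ' : ℝ≥0) : WithTop ℝ≥0) ≤ H ω := hρ' ▸ hρle
      have hUρ' : Uρ s = thrDrv κ A ρ' ω - thrDrv κ A 0 ω := by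
        show thrImageDriver W A (thrRho κ hA hδ H s ω).untopA = _
        rw [← hρ', h0, thrDrv, sub_neg_eq_add, sub_add_cancel]; rfl
      simp only [hD, stoppedProcess, hmin, hUρ']
      ring
  have hcl : ∑ s ∈ Pw, C s = thrClock W A ((min (t : WithTop ℝ≥0) (H ω)).untopA : ℝ≥0) :=
    (thrClock_eq_sum (κ := κ) (H := H) hA hδ t ω).symm
  have hval : ∑ s ∈ Pw, (D s ^ 2 - 6 * C s + 2 * Uρ s * D s) =
      stoppedProcess (fun t ω ↦ thrImageDriver (drvK κ (brownianCPath ω)) A t) H t ω ^ 2 -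
        6 * thrClock W A ((min (t : WithTop ℝ≥0) (H ω)).untopA : ℝ≥0) := by
    rw [← hsq, ← hcl, Finset.mul_sum, ← Finset.sum_sub_distrib]
    refine Finset.sum_congr rfl fun s _ ↦ ?_
    ring
  rw [← hval]
  exact hlim

/-- **The piece increment of the through-swallow driving process is continuous in time**: on
`[ρ_s, σ_s]` the process `X` is the continuous image driving function of the piece hull minus `L_{B_s}`,
left-continuous at the contact time `σ_s = b_s` by the continuity of the shift across the contact
(`Loewner.tendsto_starShift_slidHull_hullHitTime`). [cite: Lawler2005, §6.3 (continuity of U*_t)] -/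
theorem continuous_stoppedProcess_thrDrv_sub {s : Finset (Set ℂ)} (hs : s ⊆ clusterFinset hA hδ) (hH : H ω ≠ ⊤)
    (hclw : ∀ t : ℝ≥0, (t : WithTop ℝ≥0) ≤ H ω → ∀ a ∈ A, deltaCluster A δ a ⊆ closedHull (drvK κ (brownianCPath ω)) t ∨
      Disjoint (deltaCluster A δ a) (closedHull (drvK κ (brownianCPath ω)) t)) :
    Continuous fun t ↦ stoppedProcess (thrDrv κ A) (thrSigma κ hA hδ H s) t ω - stoppedProcess (thrDrv κ A) (thrRho κ hA hδ H s) t ω := by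
  rcases (thrRho_le_thrSigma (κ := κ) (hA := hA) (hδ := hδ) (H := H) s ω).eq_or_lt with heq | hlt
  · simp only [stoppedProcess, heq, sub_self]; exact continuous_const
  set W := drvK κ (brownianCPath ω) with hWdef
  have hWc : Continuous W := continuous_drvK κ _
  set B := pieceHull A s with hBdef
  have hB : IsStarHull B := isStarHull_pieceHull hA hδ hs
  obtain ⟨ρ', hρ'⟩ := WithTop.ne_top_iff_exists.1 hlt.ne_top
  obtain ⟨σ', hσ'⟩ := WithTop.ne_top_iff_exists.1 (ne_top_of_le_ne_top hH (thrSigma_le s ω))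
  have hρσ : ρ' ≤ σ' := by have := hlt.le; rw [← hρ', ← hσ'] at this; exact WithTop.coe_le_coe.1 this
  -- the process as a composition with the clamp onto `[ρ', σ']`
  have hrepr : (fun t ↦ stoppedProcess (thrDrv κ A) (thrSigma κ hA hδ H s) t ω - stoppedProcess (thrDrv κ A) (thrRho κ hA hδ H s) t ω) =
      (fun v ↦ thrDrv κ A v ω - thrDrv κ A ρ' ω) ∘ fun t ↦ min (max t ρ') σ' := by
    funext t
    simp only [Function.comp_apply, stoppedProcess, ← hρ', ← hσ']
    rcases le_total t ρ' with h | h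
    · rw [min_eq_left (by exact_mod_cast h.trans hρσ : (t : WithTop ℝ≥0) ≤ σ'), min_eq_left (by exact_mod_cast h : (t : WithTop ℝ≥0) ≤ ρ'),
        max_eq_right h, min_eq_left hρσ, sub_self, sub_self]
    · rw [max_eq_left h, min_eq_right (by exact_mod_cast h : ((ρ' : ℝ≥0) : WithTop ℝ≥0) ≤ t), ← WithTop.coe_min]
      rfl
  rw [hrepr]
  have hclamp : Continuous fun t : ℝ≥0 ↦ min (max t ρ') σ' := (continuous_id.max continuous_const).min continuous_const
  have hmaps : ∀ t : ℝ≥0, min (max t ρ') σ' ∈ Icc ρ' σ' := fun t ↦ ⟨le_min (le_max_right _ _) hρσ, min_le_right _ _⟩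
  refine ContinuousOn.comp_continuous (s := Icc ρ' σ') ?_ hclamp hmaps
  refine ContinuousOn.sub ?_ continuousOn_const
  -- continuity of `v ↦ X_v` on `[ρ', σ']`
  obtain ⟨hab, hah, hρa⟩ := pieceStart_lt_of_thrRho_lt hlt
  have hbT : pieceEnd W (clusterFinset hA hδ) s = hullHitTime W B := pieceEnd_eq_hullHitTime hWc hA hδ hs
  have haρ : pieceStart W s ≤ ρ' := by rw [hρ', hρa]
  have hσb : ((σ' : ℝ≥0) : WithTop ℝ≥0) ≤ hullHitTime W B := by rw [hσ', ← hbT]; exact min_le_left _ _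
  have hσh : ((σ' : ℝ≥0) : WithTop ℝ≥0) ≤ H ω := by rw [hσ']; exact thrSigma_le s ω
  have hlt_of_alive : ∀ w : ℝ≥0, Disjoint (closedHull W w) B → (w : WithTop ℝ≥0) < hullHitTime W B := fun w hw ↦ by
    rcases B.eq_empty_or_nonempty with hBe | hBne
    · rw [hBe, hullHitTime_eq_top_iff.2 fun t ↦ disjoint_empty _]; exact WithTop.coe_lt_top w
    · exact lt_hullHitTime_of_disjoint hWc hB hBne hw
  have hX : ∀ v : ℝ≥0, ρ' ≤ v → (v : WithTop ℝ≥0) < hullHitTime W B → v ≤ σ' → thrDrv κ A v ω = imageDriver W B v - (starShift B).re := by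
    intro v h1 h2 h3
    have hrem := remHull_eq_pieceHull_of_mem_piece hs hclw (haρ.trans (WithTop.coe_le_coe.2 h1)) (hbT ▸ h2)
      ((WithTop.coe_le_coe.2 h3).trans hσh)
    rw [thrDrv, thrImageDriver_eq_imageDriver_remHull (rfl : remHull W A v = remHull W A v), hrem]; ring
  intro v hv
  rcases (WithTop.coe_le_coe.2 hv.2 : (v : WithTop ℝ≥0) ≤ σ').trans hσb |>.lt_or_eq with hvlt | hveq
  · -- alive: the image driving function is continuous there
    have halive : Disjoint (closedHull W v) B := disjoint_closedHull_of_lt_hullHitTime hvlt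
    have hc := continuousWithinAt_imageDriver' hWc hB halive
    have hc' : ContinuousWithinAt (fun w : ℝ≥0 ↦ imageDriver W B w - (starShift B).re)
        (Icc ρ' σ' ∩ {w | Disjoint (closedHull W w) B}) v := (hc.mono inter_subset_right).sub continuousWithinAt_const
    have hnhds : Icc ρ' σ' ∩ {w | Disjoint (closedHull W w) B} ∈ 𝓝[Icc ρ' σ'] v := by
      refine inter_mem self_mem_nhdsWithin (mem_nhdsWithin_of_mem_nhds ?_)
      have hopen : IsOpen {w : ℝ≥0 | (w : WithTop ℝ≥0) < hullHitTime W B} := isOpen_Iio.preimage WithTop.continuous_coe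
      exact Filter.mem_of_superset (hopen.mem_nhds hvlt) fun w hw ↦ disjoint_closedHull_of_lt_hullHitTime hw
    refine (hc'.congr ?_ ?_).mono_of_mem_nhdsWithin hnhds
    · rintro w ⟨⟨hw1, hw2⟩, hw3⟩
      exact hX w hw1 (hlt_of_alive w hw3) hw2
    · exact hX v hv.1 hvlt hv.2
  · -- the contact time `v = σ' = T_B`: left continuity by the continuity of the shift
    have hvσ : v = σ' := le_antisymm hv.2 (WithTop.coe_le_coe.1 (hveq ▸ hσb))
    subst hvσ
    have hne : s ≠ clusterFinset hA hδ := by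
      rintro rfl
      rw [hBdef, pieceHull_clusterFinset, hullHitTime_eq_top_iff.2 fun t ↦ disjoint_empty _] at hveq
      exact WithTop.coe_ne_top hveq
    have hBne : B.Nonempty := pieceHull_nonempty hA hδ hs hne
    have hT : hullHitTime W B = v := hveq.symm
    have hrem : remHull W A v = B \ closedHull W v :=
      remHull_eq_pieceHull_diff hWc hA hδ hs haρ hv.1 (hclw ρ' (hρ' ▸ thrRho_le s ω))
    have hcl : IsClosed (B \ closedHull W v) := hrem ▸ isClosed_remHull_of_clusterwise hWc hA hδ (hclw v hσh)
    have hval : thrDrv κ A v ω = W v - (starShift (slidHull W (B \ closedHull W v) v)).re := by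
      rw [thrDrv, thrImageDriver, thrSlidHull, hrem]; ring
    -- reduce to the left limit
    rcases eq_or_lt_of_le hv.1 with hρv | hρv
    · -- degenerate interval `ρ' = σ'`
      rw [← hρv, Icc_self]; exact continuousWithinAt_singleton
    have hIcc : Icc ρ' v = insert v (Ico ρ' v) := (Ico_insert_right hv.1).symm
    rw [hIcc]
    refine ContinuousWithinAt.insert ?_
    have hL := tendsto_starShift_slidHull_hullHitTime hWc (drvK_zero κ _) hB hBne hT hcl
    have hW := (hWc.tendsto v).mono_left (nhdsWithin_le_nhds (s := Iio v))
    have hlim : Tendsto (fun w : ℝ≥0 ↦ W w - (starShift (slidHull W B w)).re) (𝓝[<] v) (𝓝 (thrDrv κ A v ω)) := by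
      rw [hval]; exact hW.sub hL
    have hlim' : Tendsto (fun w : ℝ≥0 ↦ thrDrv κ A w ω) (𝓝[<] v) (𝓝 (thrDrv κ A v ω)) := by
      refine hlim.congr' ?_
      filter_upwards [Ico_mem_nhdsLT hρv] with w hw
      rw [hX w hw.1 (hT ▸ WithTop.coe_lt_coe.2 hw.2) hw.2.le, imageDriver]; ring
    exact hlim'.mono_left (nhdsWithin_mono _ Ico_subset_Iio_self)

/-- **The stopped through-swallow driving process has continuous paths.** [cite: Lawler2005, §6.3 Thm. 6.13] -/
theorem continuous_stoppedProcess_thrImageDriver (hA : IsStarHull A) (hδ : 0 < δ) (hH : H ω ≠ ⊤)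
    (hclw : ∀ t : ℝ≥0, (t : WithTop ℝ≥0) ≤ H ω → ∀ a ∈ A, deltaCluster A δ a ⊆ closedHull (drvK κ (brownianCPath ω)) t ∨
      Disjoint (deltaCluster A δ a) (closedHull (drvK κ (brownianCPath ω)) t)) :
    Continuous fun t ↦ stoppedProcess (fun t ω ↦ thrImageDriver (drvK κ (brownianCPath ω)) A t) H t ω := by
  simp only [stoppedProcess_thrImageDriver_eq_sum (κ := κ) (H := H) hA hδ _ ω]
  exact continuous_finsetSum _ fun s hs ↦ continuous_stoppedProcess_thrDrv_sub (Finset.mem_powerset.1 hs) hH hclw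

end Pathwise


end Literature.Probability.RandomPlanarGeometry

end
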